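import Summits.ResolutionOfSingularities.ResolutionOfSingularities.Theorems.WeightedInvariantWeightedThesisHypersurfaceDatum
import Summits.ResolutionOfSingularities.ResolutionOfSingularities.Theorems.WeightedInvariantDatumToEmbeddedInvDrop
import HarnessLib

/-!
# The hypersurface tower — homogeneity of the centre and the drop of the invariant

Support for crux `stmt-ResolutionOfSingularities-0569`
(`Summit.ResolutionOfSingularities.ResolutionOfSingularities.Theses.WeightedInvariant.WeightedThesis`),
line `datum-glued-split`, RESHAPE 7 (lead c7): the two step lemmas of the cobordant tower that USE the
datum's functoriality and drop axioms — `CentreHomogeneous.stub_centre_isHomogeneous` (axiom `(i)` for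
the centre along the torus coaction) and `InvDrop.stub_inv_drop` (axiom `(i)` for `inv` along the chart
immersions `B₊(U) ⟶ B₊` and axiom `(iv)` on the charts) — re-proved for a HYPERSURFACE resolution
datum `D : HypersurfaceResolutionDatum p` (`Theorems/…HypersurfaceDatum.lean`), whose axioms carry the
guard "`X` locally principal with integral subscheme". The proofs are those of
`Theorems/WeightedInvariantDatumToEmbeddedCentreHomogeneous.lean` and `…InvDrop.lean` verbatim with the
guards threaded; the guard for the successor pair `(B₊, σˢ(X)|_{B₊})` of `inv_drop` is taken as a
hypothesis (discharged in the assembly by `…HypersurfacePreserved.isLocallyPrincipal_strictTransformPlus`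
and `…TowerGenericAmbient`'s integrality of the strict transform).

* `CentreHomogeneous.centre_isHomogeneous_of_hypersurfaceDatum`;
* `InvDrop.inv_drop_of_hypersurfaceDatum`, registered form `InvDrop.hyp_inv_drop`.
-/

noncomputable section

open scoped LaurentPolynomial
open LaurentPolynomial CategoryTheory CategoryTheory.Limits AlgebraicGeometry TopologicalSpace
open Literature.AlgebraicGeometry.Resolution
open Summit.ResolutionOfSingularities.ResolutionOfSingularities.Theorems

set_option linter.dupNamespace false -- mandated namespace `…Theorems.DatumToEmbedded.<Topic>`

/-! ## The centre is homogeneous on graded charts -/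

namespace Summit.ResolutionOfSingularities.ResolutionOfSingularities.Theorems.DatumToEmbedded.CentreHomogeneous

open AddMonoidAlgebra

/-- **On a graded ambient chart the centre of a hypersurface datum is homogeneous** (the statement of
`stub_centre_isHomogeneous` for `D : HypersurfaceResolutionDatum p`, on a hypersurface pair
`(Y, I)`): for a `𝔾ₘʲ`-stable affine chart `W ⊆ Y` — a `ℤʲ`-grading `𝒜` of `Γ(Y, W)` with the
constants in degree `0` for which `I(W)` is homogeneous — every piece `(D.centre f I).piece n` has
homogeneous ideal of sections over `W`: axiom `(i)` for the centre applied to the two smooth surjective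
`k`-morphisms `act ⊔ 𝟙_Y, pr ⊔ 𝟙_Y : (Spec Γ(Y, W)[ℤʲ]) ⊔ Y ⟶ Y`, which have the same composite to
`Spec k` and pull `I` back to the same ideal sheaf (Włodarczyk 2022, Thm. 1.1.4 (6): functoriality
for group actions). [cite: Wlodarczyk2022, Thm. 1.1.4 (6)] -/
theorem centre_isHomogeneous_of_hypersurfaceDatum
    {p : ℕ} (D : HypersurfaceResolutionDatum p) {k : Type} [Field k] [CharP k p] [PerfectField k]
    {Y : Scheme.{0}} (f : Y ⟶ Spec (.of k)) [Smooth f] [IsSeparated f] [QuasiCompact f]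
    (I : Y.IdealSheafData) (hI : IsLocallyPrincipal I) (hIi : IsIntegral I.subscheme)
    (hguard : ∃ y : Y, ¬ IsBot (D.inv f I y))
    {j : ℕ} (W : Y.affineOpens) (𝒜 : (Fin j → ℤ) → AddSubgroup Γ(Y, W)) [GradedRing 𝒜]
    (h0 : ∀ c : Γ(Spec (.of k), ⊤), f.appLE ⊤ W le_top c ∈ 𝒜 0)
    (hIhom : (I.ideal W).IsHomogeneous 𝒜) (n : ℕ) :
    (((D.centre f I).piece n).ideal W).IsHomogeneous 𝒜 := by
  obtain ⟨ρ, hρ⟩ := exists_coaction 𝒜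
  -- the torus chart `T = 𝔾ₘʲ × W` with its action and projection maps to `Y`
  let L : Type := (Γ(Y, W) : Type)[Fin j → ℤ]
  let T : Scheme.{0} := Spec (.of L)
  let φa : Γ(Y, W) ⟶ CommRingCat.of L := CommRingCat.ofHom ρ
  let φp : Γ(Y, W) ⟶ CommRingCat.of L := CommRingCat.ofHom singleZeroRingHom
  let act : T ⟶ Y := Spec.map φa ≫ W.2.fromSpec
  let pr : T ⟶ Y := Spec.map φp ≫ W.2.fromSpec
  haveI : Smooth (Spec.map φa) :=
    (HasRingHomProperty.Spec_iff (P := @Smooth)).mpr (smooth_coaction 𝒜 ρ hρ)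
  haveI : Smooth (Spec.map φp) :=
    (HasRingHomProperty.Spec_iff (P := @Smooth)).mpr (smooth_singleZeroRingHom _ j)
  haveI : Smooth act := inferInstance
  haveI : Smooth pr := inferInstance
  -- the two maps agree on `Spec k` (constants have degree `0`) …
  have hcompT : act ≫ f = pr ≫ f := by
    have key : f.appLE ⊤ W le_top ≫ φa = f.appLE ⊤ W le_top ≫ φp := by
      apply CommRingCat.hom_ext
      refine RingHom.ext fun c => ?_
      simp only [φa, φp, CommRingCat.hom_comp, CommRingCat.hom_ofHom, RingHom.comp_apply]
      exact hρ 0 _ (h0 c)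
    simp only [act, pr, Category.assoc]
    rw [← IsAffineOpen.SpecMap_appLE_fromSpec f (isAffineOpen_top _) W.2 le_top,
      ← Spec.map_comp_assoc, ← Spec.map_comp_assoc, key]
  -- … and pull `I` back to the same ideal sheaf (`I(W)` is homogeneous)
  have hcomapT : I.comap act = I.comap pr := by
    refine Scheme.IdealSheafData.ext_of_isAffine ?_
    simp only [act, pr]
    rw [comap_SpecMap_fromSpec_ideal_top, comap_SpecMap_fromSpec_ideal_top]
    simp only [φa, φp, CommRingCat.hom_ofHom]
    rw [map_coaction_eq_of_isHomogeneous 𝒜 ρ hρ hIhom]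
  -- glue each with the identity of `Y`: smooth surjective `k`-morphisms `T ⊔ Y ⟶ Y`
  obtain ⟨g, hgl, hgr, _, _, _, _⟩ : ∃ g : T ⨿ Y ⟶ Y, coprod.inl ≫ g = act ∧
      coprod.inr ≫ g = 𝟙 Y ∧ Smooth g ∧ Surjective g ∧ QuasiCompact (g ≫ f) ∧
      IsSeparated (g ≫ f) :=
    ⟨coprod.desc act (𝟙 Y), coprod.inl_desc _ _, coprod.inr_desc _ _, smooth_coprodDesc act,
      surjective_coprodDesc act, quasiCompact_coprodDesc_comp act f,
      isSeparated_coprodDesc_comp act f⟩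
  obtain ⟨g', hgl', hgr', _, _, _, _⟩ : ∃ g : T ⨿ Y ⟶ Y, coprod.inl ≫ g = pr ∧
      coprod.inr ≫ g = 𝟙 Y ∧ Smooth g ∧ Surjective g ∧ QuasiCompact (g ≫ f) ∧
      IsSeparated (g ≫ f) :=
    ⟨coprod.desc pr (𝟙 Y), coprod.inl_desc _ _, coprod.inr_desc _ _, smooth_coprodDesc pr,
      surjective_coprodDesc pr, quasiCompact_coprodDesc_comp pr f,
      isSeparated_coprodDesc_comp pr f⟩
  have hcomp : g ≫ f = g' ≫ f := by
    apply coprod.hom_ext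
    · rw [reassoc_of% hgl, reassoc_of% hgl', hcompT]
    · rw [reassoc_of% hgr, reassoc_of% hgr']
  have hcomap : I.comap g = I.comap g' := by
    refine idealSheaf_ext_of_openCover (coprodOpenCover.{0, 0} T Y) fun i => ?_
    rcases i with ⟨⟨⟩⟩ | ⟨⟨⟩⟩
    · change (I.comap g).comap coprod.inl = (I.comap g').comap coprod.inl
      rw [← Scheme.IdealSheafData.comap_comp, ← Scheme.IdealSheafData.comap_comp, hgl, hgl']
      exact hcomapT
    · change (I.comap g).comap coprod.inr = (I.comap g').comap coprod.inr
      rw [← Scheme.IdealSheafData.comap_comp, ← Scheme.IdealSheafData.comap_comp, hgr, hgr']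
  -- functoriality of the centre for `g` and `g'`, read off on the torus chart
  have hc := D.centre_comap f (g ≫ f) g rfl I hI hIi hguard n
  have hc' := D.centre_comap f (g' ≫ f) g' rfl I hI hIi hguard n
  rw [← hcomp, ← hcomap, hc] at hc'
  have hC : ((D.centre f I).piece n).comap act = ((D.centre f I).piece n).comap pr := by
    rw [← hgl, ← hgl', Scheme.IdealSheafData.comap_comp, Scheme.IdealSheafData.comap_comp, hc']
  have hC' := congrArg (fun K : T.IdealSheafData => K.ideal ⟨⊤, isAffineOpen_top T⟩) hC
  simp only [act, pr] at hC'
  rw [comap_SpecMap_fromSpec_ideal_top, comap_SpecMap_fromSpec_ideal_top] at hC'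
  simp only [φa, φp, CommRingCat.hom_ofHom] at hC'
  exact isHomogeneous_of_map_coaction_le 𝒜 ρ hρ (ideal_map_iso_inv_injective _ hC').le

end Summit.ResolutionOfSingularities.ResolutionOfSingularities.Theorems.DatumToEmbedded.CentreHomogeneous

/-! ## The invariant drops on the global cobordant blow-up -/

namespace Summit.ResolutionOfSingularities.ResolutionOfSingularities.Theorems.DatumToEmbedded.InvDrop

-- `R'.plus.ι ⁻¹ᵁ _` / chart immersions inside `rw` motives on the glued scheme (as in the source file):
set_option backward.isDefEq.respectTransparency false in
/-- **The invariant of a hypersurface datum drops on the GLOBAL cobordant blow-up** (the statement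
of `stub_inv_drop` for `D : HypersurfaceResolutionDatum p`): for a hypersurface pair `(Y, I)` with
`inv` not everywhere minimal and maximal at `y₀`, a Rees filtration `R'` with the pieces of the centre
`D.centre f I` whose cobordant blow-up `B₊ = R'.plus → Y → Spec k` is smooth separated quasi-compact,
and GRANTED that the successor pair `(B₊, σˢ(I)|_{B₊})` is again a hypersurface pair (hypotheses
`hI'`, `hI'i`), at every point `y'` of `B₊` the invariant of the successor pair is strictly below
`inv y₀`: `y' = φ_U(b)` for the chart `φ_U : B₊(U) ⟶ B₊` over some affine `U`, an open immersion
pulling `σˢ(I)|_{B₊}` back to the chartwise strict transform, so locality of `inv` (axiom `(i)`) and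
the drop on the chart (axiom `(iv)`) conclude (Włodarczyk 2022, §3.3.33, Thm. 4.3.1).
[cite: Wlodarczyk2022, Thm. 4.3.1] -/
theorem inv_drop_of_hypersurfaceDatum
    {p : ℕ} (D : HypersurfaceResolutionDatum p) {k : Type} [Field k] [CharP k p] [PerfectField k]
    {Y : Scheme.{0}} (f : Y ⟶ Spec (.of k)) [Smooth f] [IsSeparated f] [QuasiCompact f]
    (I : Y.IdealSheafData) (hI : IsLocallyPrincipal I) (hIi : IsIntegral I.subscheme)
    (hguard : ∃ y : Y, ¬ IsBot (D.inv f I y)) (y₀ : Y) (hmax : ∀ y : Y, D.inv f I y ≤ D.inv f I y₀)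
    (R' : ReesFiltration Y) (hR' : R'.ideal = (D.centre f I).piece)
    [Smooth (R'.πPlus ≫ f)] [IsSeparated (R'.πPlus ≫ f)] [QuasiCompact (R'.πPlus ≫ f)]
    (hI' : IsLocallyPrincipal (R'.strictTransformPlus I))
    (hI'i : IsIntegral (R'.strictTransformPlus I).subscheme) (y' : (R'.plus : Scheme.{0})) :
    D.inv (R'.πPlus ≫ f) (R'.strictTransformPlus I) y' < D.inv f I y₀ := by
  have hJ : ∀ U : Y.affineOpens, (R'.filtration U).ideal = (D.centre f I).chartIdeals U :=
    fun U => funext fun n => by rw [ReesFiltration.filtration_ideal, hR']; rfl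
  -- `B` and `B₊` are locally Noetherian (the centre is a regular weighted centre under the guard)
  haveI : IsLocallyNoetherian Y := LocallyOfFiniteType.isLocallyNoetherian f
  haveI : LocallyOfFiniteType R'.π := WeightedThesis.GlobalCobordantPlus.locallyOfFiniteType_π
    (D.centre f I) R' hR' (D.isRegularWeightedCentre_centre f I hI hIi hguard)
  haveI : IsLocallyNoetherian R'.cobordantBlowup := LocallyOfFiniteType.isLocallyNoetherian R'.π
  haveI : IsLocallyNoetherian (R'.plus : Scheme.{0}) :=
    LocallyOfFiniteType.isLocallyNoetherian (R'.πPlus ≫ f)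
  -- `y' = φ b` for the chart `φ = φ_U` over some affine `U`
  obtain ⟨U, hU⟩ := exists_mem_image_plusChart R' y'
  obtain ⟨θ, hθ⟩ := exists_ringEquiv (R'.filtration U) ((D.centre f I).chartIdeals U) (hJ U)
  obtain ⟨φ, hφ⟩ := exists_fac R' U _ θ hθ (hJ U)
  haveI := isOpenImmersion_of_fac R' U _ θ φ hφ
  obtain ⟨b, rfl⟩ := exists_apply_eq_of_fac R' U _ θ hθ φ hφ (hJ U) y' hU
  -- the chart is a smooth `Y`-morphism from a smooth separated quasi-compact `k`-scheme
  have hφf : φ ≫ R'.πPlus ≫ f = (D.centre f I).cobordantPlusι U ≫ f := by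
    rw [← Category.assoc, comp_πPlus_of_fac R' U _ θ hθ φ hφ]
    rfl
  haveI : Smooth ((D.centre f I).cobordantPlusι U ≫ f) := by rw [← hφf]; infer_instance
  haveI : IsSeparated ((D.centre f I).cobordantPlusι U ≫ f) := by rw [← hφf]; infer_instance
  haveI : QuasiCompact ((D.centre f I).cobordantPlusι U ≫ f) := by rw [← hφf]; infer_instance
  -- locality of `inv` along the chart (the successor pair is a hypersurface pair), then `(iv)`
  have key := D.inv_comap (R'.πPlus ≫ f) ((D.centre f I).cobordantPlusι U ≫ f) φ hφf
    (R'.strictTransformPlus I) hI' hI'i b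
  rw [comap_strictTransformPlus_of_fac R' U _ θ hθ φ hφ] at key
  exact key.symm.trans_lt (D.inv_cobordantPlus_lt f I hI hIi hguard U b y₀ hmax)

/-- **Registered form `hyp_inv_drop`** of `inv_drop_of_hypersurfaceDatum` (registered stub of line
`datum-glued-split`, RESHAPE 7, on crux stmt-0569). [cite: Wlodarczyk2022, Thm. 4.3.1] -/
theorem hyp_inv_drop : ∀ {p : ℕ} (D : Summit.ResolutionOfSingularities.ResolutionOfSingularities.Theorems.HypersurfaceResolutionDatum p) {k : Type} [Field k] [CharP k p] [PerfectField k] {Y : AlgebraicGeometry.Scheme.{0}} (f : Y ⟶ AlgebraicGeometry.Spec (.of k)) [AlgebraicGeometry.Smooth f] [AlgebraicGeometry.IsSeparated f] [AlgebraicGeometry.QuasiCompact f] (I : Y.IdealSheafData), Literature.AlgebraicGeometry.Resolution.IsLocallyPrincipal I → AlgebraicGeometry.IsIntegral I.subscheme → (∃ y : Y, ¬ IsBot (D.inv f I y)) → ∀ (y₀ : Y), (∀ y : Y, D.inv f I y ≤ D.inv f I y₀) → ∀ (R' : Literature.AlgebraicGeometry.Resolution.ReesFiltration Y), R'.ideal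 = (D.centre f I).piece → ∀ [AlgebraicGeometry.Smooth (R'.πPlus ≫ f)] [AlgebraicGeometry.IsSeparated (R'.πPlus ≫ f)] [AlgebraicGeometry.QuasiCompact (R'.πPlus ≫ f)], Literature.AlgebraicGeometry.Resolution.IsLocallyPrincipal (R'.strictTransformPlus I) → AlgebraicGeometry.IsIntegral (R'.strictTransformPlus I).subscheme → ∀ y' : (R'.plus : AlgebraicGeometry.Scheme.{0}), D.inv (R'.πPlus ≫ f) (R'.strictTransformPlus I) y' < D.inv f I y₀ := by
  intro p D k _ _ _ Y f _ _ _ I hI hIi hguard y₀ hmax R' hR' _ _ _ hI' hI'i y'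
  exact inv_drop_of_hypersurfaceDatum D f I hI hIi hguard y₀ hmax R' hR' hI' hI'i y'

end Summit.ResolutionOfSingularities.ResolutionOfSingularities.Theorems.DatumToEmbedded.InvDrop

end
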